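import Literature.MathematicalPhysics.QuantumFieldTheory.Balaban1983to89.BlockAveragingEMLHaarAC
import Literature.MathematicalPhysics.QuantumFieldTheory.Balaban1983to89.MatrixLogLipschitz
import Literature.Analysis.Complex.RungeUnits
import HarnessLib

/-!
# `AlphaInputsT3ACEMLFibreCoreInjective` — the guarded fibre map `W ↦ exp(Σ_k c_k log(h_k W*))·W` of Bałaban's block averaging (0.4) with the
# printed `exp[mean log]` is INJECTIVE on a small guard (brick (B2-F2b) of `pub/ym-inputs/I10-B2-FIBRE-LOCATE-p08.md`; cell ym3-torus, desk
# pub/ym-inputs INPUT-LIST v7 §3 I-10 ∕ I-12; seat ym-inputs-p08 g3; helper `--supports stmt-QuantumFields-20520`)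

WHY.  In the private coordinate `g = U(β(c))` of a coarse bond `c` ([Balaban1987RG1] (0.4) read through `BlockAveragingHaarAC` ∕
`BlockAveragingEMLHaarAC`), the block average `Ū(c)` is the one-variable map `W ↦ exp(Σ_k |I|⁻¹ log(h_k W*))·W` of `W = pre·g·post` on the guard
(`BlockAveragingEMLHaarAC.coe_fibreCore_eq`; `h_k` the off-central open holonomies, total weight `m/|I| < 1`).  The private-coordinate fibre chart
of `…AlphaInputsT3ACWeightedInverseChart.exists_weightedChart_of_isLocal` needs this map INJECTIVE on the region charted.  THIS FILE proves
injectivity on the SMALL guard `‖h_k W* − 1‖ ≤ ε` (all `k`) whenever the weights have total `Σ c_k ≤ θ < 1` and `10ε ≤ 1 − θ`, `ε ≤ 1/10`: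
`exp(Σ c_k log(h_k W₁*))·W₁ = exp(Σ c_k log(h_k W₂*))·W₂ ⇒ W₁ = W₂` (`fibreCore_injective_of_small`).  The proof is a Lipschitz estimate:
`W₁ − W₂ = e^{−A₂}(e^{A₂} − e^{A₁})W₁` with `A_i = Σ c_k log(h_k W_i*)`, `‖A_i‖ ≤ 2θε`, `‖A₁ − A₂‖ ≤ θ‖W₁ − W₂‖/(1 − ε)`
(`MatrixLogLipschitz.norm_mlog_sub_mlog_le`), `‖e^{A₂} − e^{A₁}‖ ≤ ‖A₁ − A₂‖e^{2ε}` (`Literature.Analysis.Complex.norm_exp_sub_exp_le`), so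
`‖W₁ − W₂‖ ≤ θ·F(ε)·‖W₁ − W₂‖` with `θ·F(ε) < 1`.  For Bałaban's weights `c_k = |I|⁻¹` over the `m < |I|` off-central indices one may take
`θ = 1 − |I|⁻¹` (`sum_emlWeight_le_one_sub_inv`), so the guard radius is `ε ≤ 1/(10·|I|)`, `|I| = L^d (d!)²` — print solves the same fibre
equation by the linearisation (17) of [Balaban1985UV3] for «A small»; here smallness enters only through this contraction.

HONEST SCOPE.  [folklore] estimates on a power series in the `L²`-operator-normed matrix algebra; nothing of [Balaban1985UV3] ∕ [Balaban1987RG1] is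
asserted; count-neutral; no summit ∕ sub-problem statement proved (rung R3 bookkeeping; not T⁴, not Clay; the Yang–Mills mass gap is NOT proved).
Def-free; L-floor: none.  References: T. Bałaban, CMP 109 (1987) 249–301 [Balaban1987RG1] ((0.4) p.253); CMP 102 (1985) 255–275 [Balaban1985UV3]
((17)–(18) p.260); CMP 98 (1985) 17–51 [Balaban1985Averaging] ((21), (26) pp.21–22).
-/

set_option autoImplicit false

noncomputable section

namespace Summit.QuantumFields.YangMills.Theorems.EMLFibreCoreInjective

open NormedSpace
open scoped Matrix.Norms.L2Operator
open Literature.MathematicalPhysics.QuantumFieldTheory.Balaban1983to89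
open Literature.MathematicalPhysics.QuantumFieldTheory.Balaban1983to89.MatrixLog (mlog norm_mlog_le_two_mul)
open Literature.MathematicalPhysics.QuantumFieldTheory.Balaban1983to89.MatrixLogLipschitz (norm_mlog_sub_mlog_le)
open Literature.Analysis.Complex (norm_exp_le_exp_norm norm_exp_sub_exp_le)

variable {n : Type*} [Fintype n] [DecidableEq n] [Nonempty n] {ι : Type*} [Fintype ι]

/-! ## §1 Elementary norm facts in the `L²`-operator-normed matrix algebra -/

omit [Nonempty n] in
/-- `‖X*‖ = ‖X‖` for the `L²`-operator norm. [folklore] -/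
theorem norm_star_eq (X : Matrix n n ℂ) : ‖star X‖ = ‖X‖ := by
  rw [Matrix.star_eq_conjTranspose, Matrix.l2_opNorm_conjTranspose]

/-- A unitary matrix has `L²`-operator norm `1`. [folklore] -/
theorem norm_eq_one_of_mem_unitaryGroup {W : Matrix n n ℂ} (hW : W ∈ Matrix.unitaryGroup n ℂ) : ‖W‖ = 1 :=
  CStarRing.norm_of_mem_unitary hW

/-- `‖h W₁* − h W₂*‖ = ‖W₁ − W₂‖` for a unitary `h` (left multiplication by a unitary is an `L²`-operator-norm isometry — the Frobenius twin is
`Federbush1986.UNGauss.frob_norm_unitary_mul`, a different norm instance). [folklore] -/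
theorem norm_mul_star_sub_mul_star {h : Matrix n n ℂ} (hh : h ∈ Matrix.unitaryGroup n ℂ) (W₁ W₂ : Matrix n n ℂ) :
    ‖h * star W₁ - h * star W₂‖ = ‖W₁ - W₂‖ := by
  -- isometry of `X ↦ h·X` for the operator norm
  have hiso : ∀ X : Matrix n n ℂ, ‖h * X‖ = ‖X‖ := fun X => by
    refine le_antisymm ((norm_mul_le _ _).trans (by rw [norm_eq_one_of_mem_unitaryGroup hh, one_mul])) ?_
    have h1 : star h * (h * X) = X := by
      rw [← mul_assoc, Matrix.mem_unitaryGroup_iff'.mp hh, one_mul]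
    calc ‖X‖ = ‖star h * (h * X)‖ := by rw [h1]
      _ ≤ ‖star h‖ * ‖h * X‖ := norm_mul_le _ _
      _ = ‖h * X‖ := by rw [norm_star_eq, norm_eq_one_of_mem_unitaryGroup hh, one_mul]
  rw [← mul_sub, hiso, ← star_sub, norm_star_eq]

omit [Nonempty n] in
/-- A weighted sum is bounded by the total weight times a uniform bound. [folklore] -/
theorem norm_sum_smul_le (c : ι → ℝ) (hc0 : ∀ k, 0 ≤ c k) (X : ι → Matrix n n ℂ) {b : ℝ} (hX : ∀ k, ‖X k‖ ≤ b) :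
    ‖∑ k, ((c k : ℝ) : ℂ) • X k‖ ≤ (∑ k, c k) * b := by
  calc ‖∑ k, ((c k : ℝ) : ℂ) • X k‖ ≤ ∑ k, ‖((c k : ℝ) : ℂ) • X k‖ := norm_sum_le _ _
    _ = ∑ k, c k * ‖X k‖ := Finset.sum_congr rfl fun k _ => by
        rw [norm_smul, Complex.norm_real, Real.norm_of_nonneg (hc0 k)]
    _ ≤ ∑ k, c k * b := Finset.sum_le_sum fun k _ => mul_le_mul_of_nonneg_left (hX k) (hc0 k)
    _ = (∑ k, c k) * b := by rw [Finset.sum_mul]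

/-! ## §2 The exponent `A(W) = Σ_k c_k log(h_k W*)`: size and Lipschitz bound on the small guard -/

omit [Nonempty n] in
/-- **SIZE OF THE EXPONENT**: `‖h_k W* − 1‖ ≤ ε ≤ 1/2` (all `k`), `Σ c_k ≤ θ` ⇒ `‖Σ c_k log(h_k W*)‖ ≤ θ·(2ε)` ((26): `‖log X‖ ≤ 2‖X − 1‖` on the
half ball). [cite: Balaban1985Averaging, (26) p.22] -/
theorem norm_exponent_le (h : ι → Matrix n n ℂ) (c : ι → ℝ) (hc0 : ∀ k, 0 ≤ c k) {θ ε : ℝ} (hθ : ∑ k, c k ≤ θ)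
    (hε0 : 0 ≤ ε) (hε : ε ≤ 1 / 2) {W : Matrix n n ℂ} (hg : ∀ k, ‖h k * star W - 1‖ ≤ ε) :
    ‖∑ k, ((c k : ℝ) : ℂ) • mlog (h k * star W)‖ ≤ θ * (2 * ε) := by
  have hb : ∀ k, ‖mlog (h k * star W)‖ ≤ 2 * ε := fun k =>
    (norm_mlog_le_two_mul ((hg k).trans hε)).trans (mul_le_mul_of_nonneg_left (hg k) (by norm_num))
  refine (norm_sum_smul_le c hc0 _ hb).trans ?_
  exact mul_le_mul_of_nonneg_right hθ (by positivity)

/-- **LIPSCHITZ BOUND OF THE EXPONENT**: on the guard `‖h_k W_i* − 1‖ ≤ ε < 1` (i = 1,2, all `k`, `h_k` unitary), `Σ c_k ≤ θ` ⇒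
`‖Σ c_k log(h_k W₁*) − Σ c_k log(h_k W₂*)‖ ≤ θ·‖W₁ − W₂‖/(1 − ε)` (`MatrixLogLipschitz.norm_mlog_sub_mlog_le` termwise).
[cite: Balaban1985Averaging, (21) p.21] -/
theorem norm_exponent_sub_exponent_le (h : ι → Matrix n n ℂ) (hh : ∀ k, h k ∈ Matrix.unitaryGroup n ℂ) (c : ι → ℝ)
    (hc0 : ∀ k, 0 ≤ c k) {θ ε : ℝ} (hθ : ∑ k, c k ≤ θ) (hε1 : ε < 1) {W₁ W₂ : Matrix n n ℂ}
    (hg₁ : ∀ k, ‖h k * star W₁ - 1‖ ≤ ε) (hg₂ : ∀ k, ‖h k * star W₂ - 1‖ ≤ ε) :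
    ‖∑ k, ((c k : ℝ) : ℂ) • mlog (h k * star W₁) - ∑ k, ((c k : ℝ) : ℂ) • mlog (h k * star W₂)‖ ≤
      θ * (‖W₁ - W₂‖ / (1 - ε)) := by
  rw [← Finset.sum_sub_distrib]
  have hb : ∀ k, ‖mlog (h k * star W₁) - mlog (h k * star W₂)‖ ≤ ‖W₁ - W₂‖ / (1 - ε) := fun k => by
    have h1 := norm_mlog_sub_mlog_le hε1 (hg₁ k) (hg₂ k)
    rwa [norm_mul_star_sub_mul_star (hh k)] at h1
  have hsmul : ∀ k, ((c k : ℝ) : ℂ) • mlog (h k * star W₁) - ((c k : ℝ) : ℂ) • mlog (h k * star W₂) =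
      ((c k : ℝ) : ℂ) • (mlog (h k * star W₁) - mlog (h k * star W₂)) := fun k => (smul_sub _ _ _).symm
  simp_rw [hsmul]
  refine (norm_sum_smul_le c hc0 _ hb).trans ?_
  have hε' : 0 ≤ ‖W₁ - W₂‖ / (1 - ε) := div_nonneg (norm_nonneg _) (by linarith)
  exact mul_le_mul_of_nonneg_right hθ hε'

/-! ## §3 Injectivity of the guarded fibre map on the small guard -/

/-- The real arithmetic of the contraction: `0 < 1 − θ`, `0 ≤ ε ≤ 1/10`, `10ε ≤ 1 − θ` ⇒
`(1 + 2ε·e^{2ε})·e^{2ε}·θ/(1 − ε) < 1` (with `e^{2ε} ≤ 1 + 4ε` from `Real.abs_exp_sub_one_le`). [folklore] -/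
theorem contraction_factor_lt_one {θ ε : ℝ} (hθ0 : 0 ≤ θ) (hθ : 0 < 1 - θ) (hε0 : 0 ≤ ε) (hε : ε ≤ 1 / 10)
    (hεθ : 10 * ε ≤ 1 - θ) : (1 + 2 * ε * Real.exp (2 * ε)) * Real.exp (2 * ε) * (θ / (1 - ε)) < 1 := by
  have he : Real.exp (2 * ε) ≤ 1 + 4 * ε := by
    have h := Real.abs_exp_sub_one_le (x := 2 * ε) (by rw [abs_of_nonneg (by linarith)]; linarith)
    rw [abs_of_nonneg (by linarith : (0:ℝ) ≤ 2 * ε)] at h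
    have := (abs_le.mp h).2
    linarith
  have he0 : 0 < Real.exp (2 * ε) := Real.exp_pos _
  have h1ε : 0 < 1 - ε := by linarith
  rw [← mul_div_assoc, div_lt_one h1ε]
  -- `(1 + 2ε e^{2ε}) e^{2ε} ≤ (1 + 2ε(1+4ε))(1+4ε) ≤ 1 + 8ε ` is not needed sharply; use `≤ 1 + 10ε − 10ε²`-type bound
  have hA : (1 + 2 * ε * Real.exp (2 * ε)) * Real.exp (2 * ε) ≤ (1 + 2 * ε * (1 + 4 * ε)) * (1 + 4 * ε) := by
    have h2 : 1 + 2 * ε * Real.exp (2 * ε) ≤ 1 + 2 * ε * (1 + 4 * ε) := by nlinarith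
    exact mul_le_mul h2 he he0.le (by nlinarith)
  have hB : (1 + 2 * ε * (1 + 4 * ε)) * (1 + 4 * ε) ≤ 1 + 8 * ε := by
    have e2 : ε * ε ≤ ε * (1 / 10) := mul_le_mul_of_nonneg_left hε hε0
    have e3 : ε * ε * ε ≤ ε * (1 / 10) * (1 / 10) := by nlinarith
    nlinarith
  have hC : (1 + 2 * ε * Real.exp (2 * ε)) * Real.exp (2 * ε) * θ ≤ (1 + 8 * ε) * θ :=
    mul_le_mul_of_nonneg_right (hA.trans hB) hθ0
  have hD : (8 * θ + 1) * (10 * ε) ≤ (8 * θ + 1) * (1 - θ) := mul_le_mul_of_nonneg_left hεθ (by linarith)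
  have hpos : 0 < (1 - θ) * (9 - 8 * θ) := mul_pos hθ (by linarith)
  nlinarith

/-- **THE GUARDED FIBRE MAP OF (0.4) IS INJECTIVE ON THE SMALL GUARD.**  Let `h_k` (`k ∈ ι`) be unitary matrices, `c_k ≥ 0` weights with
`Σ c_k ≤ θ`, `0 < 1 − θ`, and `0 ≤ ε ≤ 1/10` with `10ε ≤ 1 − θ`.  If `W₁`, `W₂` are unitary with `‖h_k W_i* − 1‖ ≤ ε` for all `k` and
`exp(Σ c_k log(h_k W₁*))·W₁ = exp(Σ c_k log(h_k W₂*))·W₂`, then `W₁ = W₂`.  (The guarded fibre map of Bałaban's block averaging with the printed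
small-loop average, `BlockAveragingEMLHaarAC.coe_fibreCore_eq`, has this form with `c_k = |I|⁻¹`.) [cite: Balaban1987RG1, (0.4) p.253] -/
theorem fibreCore_injective_of_small (h : ι → Matrix n n ℂ) (hh : ∀ k, h k ∈ Matrix.unitaryGroup n ℂ) (c : ι → ℝ)
    (hc0 : ∀ k, 0 ≤ c k) {θ ε : ℝ} (hθ : ∑ k, c k ≤ θ) (hθ1 : 0 < 1 - θ) (hε0 : 0 ≤ ε) (hε : ε ≤ 1 / 10)
    (hεθ : 10 * ε ≤ 1 - θ) {W₁ W₂ : Matrix n n ℂ} (hW₁ : W₁ ∈ Matrix.unitaryGroup n ℂ)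
    (hg₁ : ∀ k, ‖h k * star W₁ - 1‖ ≤ ε) (hg₂ : ∀ k, ‖h k * star W₂ - 1‖ ≤ ε)
    (heq : exp (∑ k, ((c k : ℝ) : ℂ) • mlog (h k * star W₁)) * W₁ = exp (∑ k, ((c k : ℝ) : ℂ) • mlog (h k * star W₂)) * W₂) :
    W₁ = W₂ := by
  letI : NormedAlgebra ℚ (Matrix n n ℂ) := NormedAlgebra.restrictScalars ℚ ℂ _
  have hθ0 : 0 ≤ θ := (Finset.sum_nonneg fun k _ => hc0 k).trans hθ
  set A₁ : Matrix n n ℂ := ∑ k, ((c k : ℝ) : ℂ) • mlog (h k * star W₁) with hA₁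
  set A₂ : Matrix n n ℂ := ∑ k, ((c k : ℝ) : ℂ) • mlog (h k * star W₂) with hA₂
  have hε2 : ε ≤ 1 / 2 := hε.trans (by norm_num)
  have hε1 : ε < 1 := hε2.trans_lt (by norm_num)
  -- sizes
  have hnA₁ : ‖A₁‖ ≤ 2 * ε := (norm_exponent_le h c hc0 hθ hε0 hε2 hg₁).trans (by nlinarith)
  have hnA₂ : ‖A₂‖ ≤ 2 * ε := (norm_exponent_le h c hc0 hθ hε0 hε2 hg₂).trans (by nlinarith)
  have hdA : ‖A₁ - A₂‖ ≤ θ * (‖W₁ - W₂‖ / (1 - ε)) := norm_exponent_sub_exponent_le h hh c hc0 hθ hε1 hg₁ hg₂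
  -- `exp` estimates
  have hdE : ‖exp A₂ - exp A₁‖ ≤ ‖A₁ - A₂‖ * Real.exp (2 * ε) := by
    rw [norm_sub_rev]
    exact (norm_exp_sub_exp_le A₁ A₂).trans (mul_le_mul_of_nonneg_left (Real.exp_le_exp.mpr (max_le hnA₁ hnA₂)) (norm_nonneg _))
  have hL : ‖exp (-A₂)‖ ≤ 1 + 2 * ε * Real.exp (2 * ε) := by
    have h1 : ‖exp (-A₂) - exp 0‖ ≤ ‖-A₂ - 0‖ * Real.exp (max ‖-A₂‖ ‖(0 : Matrix n n ℂ)‖) := norm_exp_sub_exp_le _ _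
    rw [exp_zero, sub_zero, norm_neg, norm_zero, max_eq_left (norm_nonneg _)] at h1
    calc ‖exp (-A₂)‖ ≤ ‖exp (-A₂) - 1‖ + ‖(1 : Matrix n n ℂ)‖ := norm_le_norm_sub_add _ _
      _ ≤ ‖A₂‖ * Real.exp ‖A₂‖ + 1 := by rw [norm_one]; linarith [h1]
      _ ≤ 2 * ε * Real.exp (2 * ε) + 1 := by
          gcongr
      _ = 1 + 2 * ε * Real.exp (2 * ε) := by ring
  -- the identity `W₁ − W₂ = e^{−A₂}·(e^{A₂} − e^{A₁})·W₁`
  have hinv : exp (-A₂) * exp A₂ = 1 := by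
    rw [← exp_add_of_commute (Commute.neg_left (Commute.refl A₂)), neg_add_cancel, exp_zero]
  have hid : W₁ - W₂ = exp (-A₂) * ((exp A₂ - exp A₁) * W₁) := by
    have h1 : (exp A₂ - exp A₁) * W₁ = exp A₂ * (W₁ - W₂) := by
      rw [sub_mul, heq, mul_sub]
    rw [h1, ← mul_assoc, hinv, one_mul]
  -- the contraction
  have hW₁n : ‖W₁‖ = 1 := norm_eq_one_of_mem_unitaryGroup hW₁
  have hle : ‖W₁ - W₂‖ ≤ (1 + 2 * ε * Real.exp (2 * ε)) * Real.exp (2 * ε) * (θ / (1 - ε)) * ‖W₁ - W₂‖ := by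
    calc ‖W₁ - W₂‖ = ‖exp (-A₂) * ((exp A₂ - exp A₁) * W₁)‖ := by rw [← hid]
      _ ≤ ‖exp (-A₂)‖ * (‖exp A₂ - exp A₁‖ * ‖W₁‖) := (norm_mul_le _ _).trans (mul_le_mul_of_nonneg_left (norm_mul_le _ _) (norm_nonneg _))
      _ ≤ (1 + 2 * ε * Real.exp (2 * ε)) * (‖A₁ - A₂‖ * Real.exp (2 * ε) * 1) := by
          rw [hW₁n]
          exact mul_le_mul hL (mul_le_mul_of_nonneg_right hdE zero_le_one) (by positivity) (by positivity)
      _ ≤ (1 + 2 * ε * Real.exp (2 * ε)) * (θ * (‖W₁ - W₂‖ / (1 - ε)) * Real.exp (2 * ε) * 1) := by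
          gcongr
      _ = (1 + 2 * ε * Real.exp (2 * ε)) * Real.exp (2 * ε) * (θ / (1 - ε)) * ‖W₁ - W₂‖ := by ring
  have hK := contraction_factor_lt_one hθ0 hθ1 hε0 hε hεθ
  have hK0 : 0 ≤ (1 + 2 * ε * Real.exp (2 * ε)) * Real.exp (2 * ε) * (θ / (1 - ε)) := by
    have : 0 < 1 - ε := by linarith
    positivity
  have h0 : ‖W₁ - W₂‖ = 0 := by
    by_contra hne
    have hpos : 0 < ‖W₁ - W₂‖ := lt_of_le_of_ne (norm_nonneg _) (Ne.symm hne)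
    have := lt_of_le_of_lt hle ((mul_lt_iff_lt_one_left hpos).mpr hK)
    exact lt_irrefl _ this
  exact sub_eq_zero.mp (norm_eq_zero.mp h0)

/-! ## §4 Bałaban's weights: total `m/|I| ≤ 1 − |I|⁻¹` -/

open BlockAveragingEMLHaarAC BlockAveraging in
/-- **TOTAL WEIGHT OF THE OFF-CENTRAL INDICES ≤ `1 − |I|⁻¹`**: at least one index of (0.4) at `c` is central (`offCard_lt_card`), so
`Σ_{k < m} |I|⁻¹ = m/|I| ≤ (|I| − 1)/|I|`.  (Exactly `1 − L^{1−d}`; the cheap bound suffices for the contraction.) [folklore] -/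
theorem sum_emlWeight_le_one_sub_inv {P : Params} {j : ℕ} (c : PBond P (j + 1)) :
    ∑ _k : Fin (offCard c), emlWeight P ≤ 1 - ((Fintype.card (Idx P) : ℝ))⁻¹ := by
  have hI : (0 : ℝ) < Fintype.card (Idx P) := Nat.cast_pos.mpr Fintype.card_pos
  have hlt := offCard_lt_card c
  have hle : (offCard c : ℝ) ≤ (Fintype.card (Idx P) : ℝ) - 1 := by
    have : (offCard c : ℝ) + 1 ≤ Fintype.card (Idx P) := by exact_mod_cast hlt
    linarith
  rw [Finset.sum_const, Finset.card_univ, Fintype.card_fin, nsmul_eq_mul, emlWeight]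
  rw [show (1 : ℝ) - ((Fintype.card (Idx P) : ℝ))⁻¹ = ((Fintype.card (Idx P) : ℝ) - 1) * ((Fintype.card (Idx P) : ℝ))⁻¹ by
    field_simp]
  exact mul_le_mul_of_nonneg_right hle (inv_nonneg.mpr hI.le)

end Summit.QuantumFields.YangMills.Theorems.EMLFibreCoreInjective

end
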